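import Mathlib.RingTheory.AlgebraicIndependent.Transcendental
import Mathlib.RingTheory.AlgebraicIndependent.Basic
import Mathlib.Algebra.MvPolynomial.Equiv
import Mathlib.Algebra.Polynomial.Lifts
import Literature.NumberTheory.Transcendental.GammaFields
import Literature.NumberTheory.Transcendental.GammaFieldsEcl
import Literature.NumberTheory.Transcendental.ZilberSaturation
import Literature.NumberTheory.Transcendental.ZilberProofs
import Literature.NumberTheory.Transcendental.ZilberFieldCCP
import Literature.ModelTheory.Quasiminimal.PregeometryStructures
import Literature.NumberTheory.Transcendental.RosenlichtProp4Residues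
import Literature.NumberTheory.Transcendental.ZilberFieldHomogeneity
import HarnessLib

/-!
# Bays–Kirby 2018, Cor. 11.7 (exponential case) and Thm 1.5: proofs from the named facts

M. Bays, J. Kirby, *Pseudo-exponential maps, variants, and quasiminimality*, Algebra & Number
Theory 12 (2018) 493–549 (arXiv:1512.04262):

* **Thm 1.5.** If `ℂ_exp` is exponentially-algebraically closed then it is quasiminimal — the
  named fact `Literature.NumberTheory.Transcendental.isQuasiminimal_of_isExpAlgClosed` (`Zilber.lean`);
* **Cor. 11.7.** A full Γ-field with the countable closure property which is Γ-closed is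
  quasiminimal — exponential case: the named fact
  `Literature.NumberTheory.Transcendental.BaysKirby2018_isQuasiminimal_of_isExpAlgClosed_of_ccp` (`ZilberProofs.lean`, where Thm 1.5
  is reduced to it and to CCP for `ℂ_exp`, the latter proved in `ZilberFieldCCP.lean`).

Here both are **proved from the two deep results on which the printed proof rests**:

1. Ax's theorem (Ax 1971 Thm 3 = Kirby 2010 Thm 5.1), `Literature.NumberTheory.Transcendental.ax_schanuel` — which
   gives Kirby 2010 Thm 1.2 (`Literature.NumberTheory.Transcendental.succ_le_relTrdeg_of_isEclClosed`, via the Khovanskii dichotomy)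
   and hence "`ecl`-closed sets are Γ-closed and strong" (`GammaFieldsEcl.lean`,
   `isGammaClosed_span_ecl`; Bays–Kirby Remark 10.10, Props 10.6–10.7) — kept as a hypothesis
   `hAx` in the main statements and discharged at the end by the tree's proof
   `Literature.NumberTheory.Transcendental.ax_schanuel_holds` (`RosenlichtProp4Residues.lean`);
2. Bays–Kirby's `ℵ₀`-saturation of Γ-closed fields for Γ-algebraic extensions which are purely
   Γ-transcendental over a countable Γ-closed `K` (Prop. 11.5, via the weak Zilber–Pink theorem,
   and Prop. 11.2), `Literature.NumberTheory.Transcendental.BaysKirby2018_saturation_of_isExpAlgClosed` (`ZilberSaturation.lean`) —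
   the only named fact left in `isQuasiminimal_of_isExpAlgClosed_of_saturation`.

Everything else — the Γ-field algebra of §§3–4 (`GammaFields.lean`), CCP for `ℂ_exp`
(`ZilberFieldCCP.lean`), Karp's lemma (`PregeometryStructures.lean`) and the back-and-forth
argument below — is proved.

## The argument (Thm 11.6 unwound in the exponential case, inside `F`)

Bays–Kirby prove Thm 11.6 (`F` full with CCP, generically Γ-closed over a countable
`K ◁_cl F` ⟹ `F` quasiminimal) by recognising `F` as a model of the quasiminimal excellent class
of the Fraïssé limit `M_tr(K)` of the purely Γ-transcendental category `C^tr(K)` (Thm 5.21,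
Thm 6.9, Fact 6.4 = Bays–Hart–Hyttinen–Kesälä–Kirby 2014). Unwound, quasiminimality of `F` is the
statement that Γ-isomorphisms over `K` between strong finitely generated Γ-subfields of `F` form a
back-and-forth system for `L_exp = ⟨+, ·, -, 0, 1, exp⟩` (proof of Thm 6.9: QM4 by the uniqueness
of the generic type, Lemma 4.13; extension over Γ-algebraic steps by `ℵ₀`-saturation), followed by
Karp's lemma. We run exactly this argument inside `F` (vocabulary of `GammaFields.lean`: a
Γ-subfield finitely generated over `K` is `K + ℚc` for a tuple `c`; `IsStrong` = `◁ F`):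

* *states* are Γ-isomorphisms `c ↦ c'` over `K` (`GammaField.IsGammaIso`, `ZilberSaturation.lean`)
  with `K + ℚc ◁ F` and `K + ℚc' ◁ F`;
* `GammaField.IsGammaIso.snoc` (Lemma 4.13, generic good bases): generic elements on both sides
  extend a state — pure algebra: at each level the new generators `(d, exp (d/M!))` are
  algebraically independent over the level algebra (shared with the sibling file
  `ZilberFieldHomogeneity.lean`: `ZilberHomogeneity.algebraicIndependent_lvGens_singleton`,
  `GammaField.IsGammaIso.append_singleton`);
* `GammaField.IsGammaIso.exists_extension` (forth): the hull dichotomy — minimise `δ` over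
  `K + ℚc + ℚd`; if the minimum is `0` the extension is Γ-algebraic and the saturation fact embeds
  it on the other side; if it is `1`, `d` is generic with `K + ℚc + ℚd ◁ F`, and a generic partner
  `d'` is found outside the countable Γ-closed set `ecl (K ∪ c')` (CCP and uncountability of `F`,
  Lemma 4.13 = `IsStrong.sup_span_singleton`);
* `isBackAndForth_gammaIso`: these states form a back-and-forth system (atomic `L_exp`-formulas
  are preserved because values of terms can be adjoined to a state, `exists_state_realize_term`,
  and equalities transfer along Γ-isomorphisms; back = forth by symmetry);
* `isQuasiminimal_of_isExpAlgClosed_of_ccp_of_facts`: for a definable `S = φ(F; b)`, `H = ecl b`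
  is countable (CCP) and Γ-closed, `K = ecl ∅ ≠ F` is countable and Γ-closed; for `a, a' ∉ H` the
  hull `D₀` of `K + ℚb` inside `H` is strong and `(D₀, a) ↦ (D₀, a')` is a state, so by Karp's
  lemma (`FirstOrder.Language.realize_iff_of_isBackAndForth`) `a ∈ S ↔ a' ∈ S`; hence `S ⊆ H` or
  `F ∖ S ⊆ H`. Countable `F` are trivially quasiminimal.

Finally `BaysKirby2018_isQuasiminimal_of_isExpAlgClosed_of_ccp_of_facts` (Cor. 11.7, exponential
case, universe `0` — `ax_schanuel` is stated in universe `0`) and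
`Literature.NumberTheory.Transcendental.isQuasiminimal_of_isExpAlgClosed_of_facts` (Thm 1.5) assemble the pieces, and the
`…_of_saturation` variants feed in `ax_schanuel_holds`.

## References

* M. Bays, J. Kirby, *Pseudo-exponential maps, variants, and quasiminimality*, Algebra & Number
  Theory 12 (2018) 493–549: Thm 1.5, Def. 3.8, Lemma 4.13, Def. 5.14, Fact 6.4, Thm 6.9 (proof),
  Remark 10.10, Prop. 11.2, Prop. 11.5, Thm 11.6 (proof), Cor. 11.7.
* M. Bays, B. Hart, T. Hyttinen, M. Kesälä, J. Kirby, *Quasiminimal structures and excellence*,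
  Bull. LMS 46 (2014) 155–163, Thm 2.3, Prop. 7.1 (Karp / quasiminimality from back-and-forth).
* J. Kirby, *Exponential algebraicity in exponential fields*, Bull. LMS 42 (2010), Thm 1.2.
-/

noncomputable section

open Set

namespace Literature.NumberTheory.Transcendental

namespace GammaField


/-! ### Shared algebra

The generic-extension algebra (relation ideals of composite families, level algebras inside
`acl`, algebraic independence of the division points of a generic element, extension of a
Γ-isomorphism by a generic element) is shared with the sibling file
`ZilberFieldHomogeneity.lean` (Zilber-field case, base `ℚτ`), which owns it:
`ZilberHomogeneity.ker_aeval_sumElim_eq`, `ZilberHomogeneity.ker_aeval_comp_eq`,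
`ZilberHomogeneity.coe_lvAlgebra_subset_acl`, `ZilberHomogeneity.algebraicIndependent_lvGens_singleton`,
`GammaField.IsGammaIso.append_singleton`, `ZilberHomogeneity.range_append`. -/

variable {F : Type*} [Field F] [CharZero F] [Literature.ModelTheory.ExponentialFields.ExponentialRing F]
variable {K : Submodule ℚ F} {N : ℕ}

omit [Literature.ModelTheory.ExponentialFields.ExponentialRing F] in
/-- `K + ℚ(snoc c d) = (K + ℚc) + ℚd`. [folklore] -/
theorem sup_span_range_snoc (K : Submodule ℚ F) (c : Fin N → F) (d : F) :
    K ⊔ Submodule.span ℚ (range (Fin.snoc c d : Fin (N + 1) → F)) =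
      (K ⊔ Submodule.span ℚ (range c)) ⊔ Submodule.span ℚ {d} := by
  rw [Fin.range_snoc, Submodule.span_insert, sup_assoc, sup_comm (Submodule.span ℚ {d})]

omit [Literature.ModelTheory.ExponentialFields.ExponentialRing F] in
/-- `K + ℚ(c, e) = (K + ℚc) + ℚe`. [folklore] -/
theorem sup_span_range_append (K : Submodule ℚ F) {k : ℕ} (c : Fin N → F) (e : Fin k → F) :
    K ⊔ Submodule.span ℚ (range (Fin.append c e)) =
      (K ⊔ Submodule.span ℚ (range c)) ⊔ Submodule.span ℚ (range e) := by
  rw [ZilberHomogeneity.range_append, Submodule.span_union, sup_assoc]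

/-- `δ(d/Λ) ≤ 1` for a single element. [folklore] -/
theorem predim_span_singleton_le_one (Λ : Submodule ℚ F) (d : F) :
    predim Λ (Submodule.span ℚ {d}) ≤ 1 := by
  by_cases hd : d ∈ Λ
  · rw [predim_eq_zero_of_le ((Submodule.span_singleton_le_iff_mem d Λ).2 hd)]; exact zero_le_one
  · exact predim_span_singleton_le hd

/-! ### Generic simple extensions of Γ-isomorphisms (Bays–Kirby Lemma 4.13, "good bases") -/

/-- **Uniqueness of generic simple extensions** (`Fin.snoc` form of
`GammaField.IsGammaIso.append_singleton` of `ZilberFieldHomogeneity.lean`). If `c ↦ c'` is a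
Γ-isomorphism over `K` and `d`, `d'` are generic over the respective Γ-fields
(`td(d, exp d/⟨K c⟩) = 2`, `td(d', exp d'/⟨K c'⟩) = 2`), then `(c, d) ↦ (c', d')` is again a
Γ-isomorphism over `K` — the case "`α ∈ Γ(F)` generic in `G` over `A` is a good basis, so
`θ₀ : A ≅ A'` extends to `⟨Aα⟩ ≅ ⟨A'α'⟩`" of Bays–Kirby 2018 (§3.4 and Lemma 4.13; in the
exponential case `Γ(F) ≅ 𝔾ₐ(F)` is uniquely divisible, so no Kummer theory intervenes).
[cite: BaysKirby2018ANT, Lemma 4.13] -/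
theorem IsGammaIso.snoc {c c' : Fin N → F} (h : IsGammaIso K c c') {d d' : F}
    (hd : td (K ⊔ Submodule.span ℚ (range c)) (Submodule.span ℚ {d}) = 2)
    (hd' : td (K ⊔ Submodule.span ℚ (range c')) (Submodule.span ℚ {d'}) = 2) :
    IsGammaIso K (Fin.snoc c d : Fin (N + 1) → F) (Fin.snoc c' d') := by
  have h1 := h.append_singleton hd hd'
  rwa [Fin.append_right_eq_snoc, Fin.append_right_eq_snoc] at h1

/-! ### One-point extensions (forth): the hull dichotomy -/

/-- **Forth.** Let `F` be an uncountable full EAC exponential field with the countable closure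
property, granted Ax's theorem and Bays–Kirby's saturation
(`BaysKirby2018_saturation_of_isExpAlgClosed`); let `K ◁_cl F` be countable and Γ-closed,
`K ≠ F`. If `c ↦ c'` is a Γ-isomorphism over `K` between tuples generating *strong* subspaces
`K + ℚc ◁ F`, `K + ℚc' ◁ F`, then for every `d ∈ F` it extends to a Γ-isomorphism
`(c, e) ↦ (c', e')` over `K` with `e₀ = d` and both sides strong. Proof (Bays–Kirby, proofs of
Thm 6.9 / Thm 11.6): let `E ⊇ K + ℚc + ℚd` minimise `δ(·/K + ℚc)`; then `E ◁ F` and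
`δ(E/K + ℚc) ∈ {0, 1}`. If it is `0`, the extension is Γ-algebraic and saturation embeds it on
the other side. If it is `1`, then `d` is generic and `K + ℚc + ℚd ◁ F`; choose `d'` outside the
countable Γ-closed `ecl (K ∪ c')` (CCP, `F` uncountable): by Lemma 4.13
(`IsStrong.sup_span_singleton`) `K + ℚc' + ℚd' ◁ F` with `d'` generic, and `IsGammaIso.snoc`
applies. [cite: BaysKirby2018ANT, Thm 11.6 (proof), Thm 6.9 (proof, QM4)] -/
theorem IsGammaIso.exists_extension {F : Type} [Field F] [CharZero F] [Literature.ModelTheory.ExponentialFields.ExponentialRing F]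
    [Uncountable F] (hF : IsAlgClosed F) (hsurj : Literature.ModelTheory.ExponentialFields.ExponentialRing.IsSurjectiveOntoUnits F)
    (hEAC : IsExpAlgClosed F) (hccp : HasCountableClosureProperty F)
    (hAx : Transcendental.ax_schanuel)
    (hSAT : BaysKirby2018_saturation_of_isExpAlgClosed.{0})
    {K : Submodule ℚ F} (hKΓ : IsGammaClosed K) (hKtop : K ≠ ⊤) (hKc : (K : Set F).Countable)
    {N : ℕ} {c c' : Fin N → F} (h : IsGammaIso K c c')
    (hs : IsStrong (K ⊔ Submodule.span ℚ (range c)))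
    (hs' : IsStrong (K ⊔ Submodule.span ℚ (range c'))) (d : F) :
    ∃ (k : ℕ) (e e' : Fin (k + 1) → F), e 0 = d ∧
      IsGammaIso K (Fin.append c e) (Fin.append c' e') ∧
      IsStrong (K ⊔ Submodule.span ℚ (range (Fin.append c e))) ∧
      IsStrong (K ⊔ Submodule.span ℚ (range (Fin.append c' e'))) := by
  classical
  set D := K ⊔ Submodule.span ℚ (range c) with hD
  set D' := K ⊔ Submodule.span ℚ (range c') with hD'
  have hfgd : IsFG D (D ⊔ Submodule.span ℚ {d}) :=
    isFG_sup_left.2 (isFG_span_of_finite D (finite_singleton d))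
  obtain ⟨E, hDE, hfgE, -, hmin⟩ :=
    hs.exists_forall_predim_le (fun _ => True) le_sup_left hfgd trivial
  have hEstrong : IsStrong E := isStrong_of_forall_predim_le (le_sup_left.trans hDE) hfgE
    fun X hX hfgX => hmin X (hDE.trans hX) hfgX trivial
  have h0 : 0 ≤ predim D E := hs (le_sup_left.trans hDE) hfgE
  have h1 : predim D E ≤ 1 := by
    have := hmin _ le_rfl hfgd trivial
    rw [predim_sup_left] at this
    exact this.trans (predim_span_singleton_le_one D d)
  rcases Int.le_iff_eq_or_lt.1 h1 with hm1 | hm0'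
  · -- `δ = 1`: `d` is generic over `D`, and `D + ℚd ◁ F`
    have hd1 : predim D (Submodule.span ℚ {d}) = 1 := by
      refine le_antisymm (predim_span_singleton_le_one D d) ?_
      have := hmin _ le_rfl hfgd trivial
      rw [predim_sup_left] at this
      omega
    have hdD : d ∉ D := by
      intro hdD
      rw [predim_eq_zero_of_le ((Submodule.span_singleton_le_iff_mem d D).2 hdD)] at hd1
      exact zero_ne_one hd1
    have hDd : IsStrong (D ⊔ Submodule.span ℚ {d}) :=
      isStrong_of_forall_predim_le le_sup_left hfgd fun X hX hfgX => by
        rw [predim_sup_left, hd1]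
        have := hmin X hX hfgX trivial
        omega
    have htd : td D (Submodule.span ℚ {d}) = 2 := td_span_singleton_eq_two hdD hd1
    -- the other side: a generic `d'` outside `ecl (K ∪ c')`
    set C₀ : Set F := (K : Set F) ∪ range c' with hC₀
    have hC₀c : C₀.Countable := hKc.union (countable_range c')
    obtain ⟨d', hd'⟩ : ∃ d', d' ∉ ecl C₀ := by
      by_contra! hall
      exact not_countable_univ ((hccp C₀ hC₀c).mono fun x _ => hall x)
    set H' := Submodule.span ℚ (ecl C₀) with hH'
    have hH'Γ : IsGammaClosed H' := isGammaClosed_span_ecl hAx C₀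
    have hD'H' : D' ≤ H' :=
      sup_le (fun x hx => subset_span_ecl C₀ (Or.inl hx))
        (Submodule.span_le.2 fun x hx => subset_span_ecl C₀ (Or.inr hx))
    have hd'H : d' ∉ H' := by rwa [hH', mem_span_ecl_iff]
    obtain ⟨hD'd', hd'1⟩ := hs'.sup_span_singleton hH'Γ hD'H' hd'H
    have hd'D' : d' ∉ D' := fun h => hd'H (hD'H' h)
    have htd' : td D' (Submodule.span ℚ {d'}) = 2 := td_span_singleton_eq_two hd'D' hd'1
    have hiso : IsGammaIso K (Fin.snoc c d : Fin (N + 1) → F) (Fin.snoc c' d') := h.snoc htd htd'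
    refine ⟨0, ![d], ![d'], rfl, ?_, ?_, ?_⟩
    · rw [Fin.append_right_eq_snoc, Fin.append_right_eq_snoc]
      exact hiso
    · rw [Fin.append_right_eq_snoc, Matrix.cons_val_zero, sup_span_range_snoc]
      exact hDd
    · rw [Fin.append_right_eq_snoc, Matrix.cons_val_zero, sup_span_range_snoc]
      exact hD'd'
  · -- `δ = 0`: Γ-algebraic, embed by saturation
    have hm0 : predim D E = 0 := by omega
    obtain ⟨s, hsE, hEle⟩ := isFG_iff_exists_finset.1 hfgE
    let e : Fin (s.card + 1) → F := Fin.cons d fun i => ((s.equivFin.symm i : s) : F)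
    have hrange : range e = insert d (s : Set F) := by
      simp only [e, Fin.range_cons]
      congr 1
      ext x
      constructor
      · rintro ⟨i, rfl⟩; exact (s.equivFin.symm i).2
      · intro hx; exact ⟨s.equivFin ⟨x, hx⟩, by simp⟩
    have hdE : d ∈ E := hDE (Submodule.mem_sup_right (Submodule.mem_span_singleton_self d))
    have hE : D ⊔ Submodule.span ℚ (range e) = E := by
      refine le_antisymm (sup_le (le_sup_left.trans hDE) (Submodule.span_le.2 ?_)) ?_
      · rw [hrange]
        exact insert_subset hdE hsE
      · refine hEle.trans (sup_le_sup_left (Submodule.span_mono ?_) _)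
        rw [hrange]
        exact subset_insert _ _
    have happ : K ⊔ Submodule.span ℚ (range (Fin.append c e)) = E := by
      rw [sup_span_range_append, ← hD, hE]
    have hδ : predim D (Submodule.span ℚ (range e)) = 0 := by
      rw [← predim_sup_left, hE]; exact hm0
    obtain ⟨e', hiso, hstr⟩ :=
      hSAT hF hsurj hEAC hKΓ hKtop hKc hs hs' h hδ (by rw [happ]; exact hEstrong)
    exact ⟨s.card, e, e', by simp [e], hiso, by rw [happ]; exact hEstrong, hstr⟩


end GammaField

/-! ### The back-and-forth system of Γ-isomorphisms and Karp's lemma -/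

section Karp

open FirstOrder FirstOrder.Language GammaField

variable {F : Type} [Field F] [CharZero F] [Literature.ModelTheory.ExponentialFields.ExponentialRing F] [Uncountable F]
variable (hF : IsAlgClosed F) (hsurj : Literature.ModelTheory.ExponentialFields.ExponentialRing.IsSurjectiveOntoUnits F)
  (hEAC : IsExpAlgClosed F) (hccp : HasCountableClosureProperty F)
  (hAx : Transcendental.ax_schanuel)
  (hSAT : BaysKirby2018_saturation_of_isExpAlgClosed.{0})
variable {K : Submodule ℚ F} (hKΓ : IsGammaClosed K) (hKtop : K ≠ ⊤) (hKc : (K : Set F).Countable)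

include hF hsurj hEAC hccp hAx hSAT hKΓ hKtop hKc

/-- **Values of terms are captured by extensions.** Given a state — a Γ-isomorphism `c ↦ c'`
over `K` between tuples generating strong subspaces, whose coordinates cover the valuations
`(v, xs)` and `(v', ys)` — and an `L_exp`-term `t`, there is an extended state with a
coordinate `j` carrying `t(v, xs)` on the left and `t(v', ys)` on the right (induction on `t`,
extending by the value of each subterm via `IsGammaIso.exists_extension`; the new coordinate on
the right is forced by the linear/monomial/exponential relation defining it, which transfers
along the Γ-isomorphism). [cite: BaysKirby2018ANT, Thm 6.9 (proof)] -/
theorem exists_state_realize_term {α : Type*} {n : ℕ} (t : Literature.ModelTheory.ExponentialFields.Language.expRing.Term (α ⊕ Fin n))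
    {v v' : α → F} {xs ys : Fin n → F} {N : ℕ} {c c' : Fin N → F} (hiso : IsGammaIso K c c')
    (hs : IsStrong (K ⊔ Submodule.span ℚ (range c)))
    (hs' : IsStrong (K ⊔ Submodule.span ℚ (range c')))
    (hv : ∀ i, ∃ j, c j = v i ∧ c' j = v' i) (hx : ∀ i, ∃ j, c j = xs i ∧ c' j = ys i) :
    ∃ (N₁ : ℕ) (c₁ c₁' : Fin N₁ → F), IsGammaIso K c₁ c₁' ∧
      IsStrong (K ⊔ Submodule.span ℚ (range c₁)) ∧ IsStrong (K ⊔ Submodule.span ℚ (range c₁')) ∧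
      (∀ i, ∃ j, c₁ j = c i ∧ c₁' j = c' i) ∧
      ∃ j, c₁ j = t.realize (Sum.elim v xs) ∧ c₁' j = t.realize (Sum.elim v' ys) := by
  classical
  -- one extension step by a prescribed element, keeping track of a defining relation
  have step : ∀ {N : ℕ} {c c' : Fin N → F}, IsGammaIso K c c' →
      IsStrong (K ⊔ Submodule.span ℚ (range c)) → IsStrong (K ⊔ Submodule.span ℚ (range c')) →
      ∀ d : F, ∃ (N₁ : ℕ) (c₁ c₁' : Fin N₁ → F), IsGammaIso K c₁ c₁' ∧
        IsStrong (K ⊔ Submodule.span ℚ (range c₁)) ∧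
        IsStrong (K ⊔ Submodule.span ℚ (range c₁')) ∧
        (∃ g : Fin N → Fin N₁, (∀ i, c₁ (g i) = c i) ∧ (∀ i, c₁' (g i) = c' i)) ∧
        ∃ j, c₁ j = d := by
    intro N c c' hiso hs hs' d
    obtain ⟨k, e, e', he0, hiso₁, hs₁, hs₁'⟩ :=
      hiso.exists_extension hF hsurj hEAC hccp hAx hSAT hKΓ hKtop hKc hs hs' d
    refine ⟨N + (k + 1), Fin.append c e, Fin.append c' e', hiso₁, hs₁, hs₁',
      ⟨Fin.castAdd (k + 1), fun i => Fin.append_left _ _ i, fun i => Fin.append_left _ _ i⟩,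
      Fin.natAdd N 0, ?_⟩
    rw [Fin.append_right, he0]
  induction t generalizing N c c' with
  | var a =>
    refine ⟨N, c, c', hiso, hs, hs', fun i => ⟨i, rfl, rfl⟩, ?_⟩
    rcases a with i | i
    · obtain ⟨j, hj, hj'⟩ := hv i
      exact ⟨j, by rw [Term.realize_var, Sum.elim_inl, hj],
        by rw [Term.realize_var, Sum.elim_inl, hj']⟩
    · obtain ⟨j, hj, hj'⟩ := hx i
      exact ⟨j, by rw [Term.realize_var, Sum.elim_inr, hj],
        by rw [Term.realize_var, Sum.elim_inr, hj']⟩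
  | func f ts ih =>
    -- evaluate the arguments one after the other, threading the state
    have args : ∀ (m : ℕ) (hm : m ≤ _) , ∃ (N₁ : ℕ) (c₁ c₁' : Fin N₁ → F), IsGammaIso K c₁ c₁' ∧
        IsStrong (K ⊔ Submodule.span ℚ (range c₁)) ∧
        IsStrong (K ⊔ Submodule.span ℚ (range c₁')) ∧
        (∀ i, ∃ j, c₁ j = c i ∧ c₁' j = c' i) ∧
        ∀ l (hl : l < m), ∃ j, c₁ j = (ts ⟨l, lt_of_lt_of_le hl hm⟩).realize (Sum.elim v xs) ∧
          c₁' j = (ts ⟨l, lt_of_lt_of_le hl hm⟩).realize (Sum.elim v' ys) := by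
      intro m
      induction m with
      | zero =>
        intro _
        exact ⟨N, c, c', hiso, hs, hs', fun i => ⟨i, rfl, rfl⟩,
          fun l hl => (Nat.not_lt_zero l hl).elim⟩
      | succ m ihm =>
        intro hm
        obtain ⟨N₁, c₁, c₁', hiso₁, hs₁, hs₁', hcov₁, hval₁⟩ := ihm (Nat.le_of_succ_le hm)
        have hv₁ : ∀ i, ∃ j, c₁ j = v i ∧ c₁' j = v' i := fun i => by
          obtain ⟨j, hj, hj'⟩ := hv i
          obtain ⟨j₁, h1, h1'⟩ := hcov₁ j
          exact ⟨j₁, h1.trans hj, h1'.trans hj'⟩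
        have hx₁ : ∀ i, ∃ j, c₁ j = xs i ∧ c₁' j = ys i := fun i => by
          obtain ⟨j, hj, hj'⟩ := hx i
          obtain ⟨j₁, h1, h1'⟩ := hcov₁ j
          exact ⟨j₁, h1.trans hj, h1'.trans hj'⟩
        obtain ⟨N₂, c₂, c₂', hiso₂, hs₂, hs₂', hcov₂, j₂, hj₂, hj₂'⟩ :=
          ih ⟨m, hm⟩ hiso₁ hs₁ hs₁' hv₁ hx₁
        refine ⟨N₂, c₂, c₂', hiso₂, hs₂, hs₂', fun i => ?_, fun l hl => ?_⟩
        · obtain ⟨j, hj, hj'⟩ := hcov₁ i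
          obtain ⟨j', h1, h1'⟩ := hcov₂ j
          exact ⟨j', h1.trans hj, h1'.trans hj'⟩
        · rcases Nat.lt_succ_iff_lt_or_eq.1 hl with hl' | rfl
          · obtain ⟨j, hj, hj'⟩ := hval₁ l hl'
            obtain ⟨j', h1, h1'⟩ := hcov₂ j
            exact ⟨j', h1.trans hj, h1'.trans hj'⟩
          · exact ⟨j₂, hj₂, hj₂'⟩
    obtain ⟨N₁, c₁, c₁', hiso₁, hs₁, hs₁', hcov₁, hval₁⟩ := args _ le_rfl
    -- the value of `func f ts`
    have hreal : ∀ (w : α ⊕ Fin n → F), (Term.func f ts).realize w =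
        Structure.funMap f fun i => (ts i).realize w := fun w => rfl
    -- add the value on the left; the value on the right is then forced
    obtain ⟨N₂, c₂, c₂', hiso₂, hs₂, hs₂', ⟨g, hg, hg'⟩, j, hj⟩ :=
      step hiso₁ hs₁ hs₁' ((Term.func f ts).realize (Sum.elim v xs))
    refine ⟨N₂, c₂, c₂', hiso₂, hs₂, hs₂', fun i => ?_, j, hj, ?_⟩
    · obtain ⟨j₁, h1, h1'⟩ := hcov₁ i
      exact ⟨g j₁, (hg j₁).trans h1, (hg' j₁).trans h1'⟩
    -- indices of the arguments in the final state
    have hargs : ∀ i : Fin _, ∃ j', c₂ j' = (ts i).realize (Sum.elim v xs) ∧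
        c₂' j' = (ts i).realize (Sum.elim v' ys) := fun i => by
      obtain ⟨j₁, h1, h1'⟩ := hval₁ i.1 i.2
      exact ⟨g j₁, (hg j₁).trans h1, (hg' j₁).trans h1'⟩
    -- transfer the defining relation along the Γ-isomorphism (level `0`)
    have transfer : ∀ P : MvPolynomial (Fin N₂ ⊕ Fin N₂) (fieldOf K),
        MvPolynomial.aeval (lvGens 0 c₂) P = 0 → MvPolynomial.aeval (lvGens 0 c₂') P = 0 :=
      fun P => (hiso₂.aeval_eq_zero_iff 0 P).1
    cases f with
    | add =>
      obtain ⟨j₀, h0, h0'⟩ := hargs 0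
      obtain ⟨j₁, h1, h1'⟩ := hargs 1
      have := transfer (MvPolynomial.X (Sum.inl j) - (MvPolynomial.X (Sum.inl j₀) +
        MvPolynomial.X (Sum.inl j₁))) (by simp [hj, hreal, h0, h1])
      simp only [map_sub, map_add, MvPolynomial.aeval_X, lvGens_inl, sub_eq_zero] at this
      rw [this, hreal, Literature.ModelTheory.ExponentialFields.Language.expRing.funMap_add, h0', h1']
    | mul =>
      obtain ⟨j₀, h0, h0'⟩ := hargs 0
      obtain ⟨j₁, h1, h1'⟩ := hargs 1
      have := transfer (MvPolynomial.X (Sum.inl j) - (MvPolynomial.X (Sum.inl j₀) *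
        MvPolynomial.X (Sum.inl j₁))) (by simp [hj, hreal, h0, h1])
      simp only [map_sub, map_mul, MvPolynomial.aeval_X, lvGens_inl, sub_eq_zero] at this
      rw [this, hreal, Literature.ModelTheory.ExponentialFields.Language.expRing.funMap_mul, h0', h1']
    | neg =>
      obtain ⟨j₀, h0, h0'⟩ := hargs 0
      have := transfer (MvPolynomial.X (Sum.inl j) + MvPolynomial.X (Sum.inl j₀))
        (by simp [hj, hreal, h0])
      simp only [map_add, MvPolynomial.aeval_X, lvGens_inl, add_eq_zero_iff_eq_neg] at this
      rw [this, hreal, Literature.ModelTheory.ExponentialFields.Language.expRing.funMap_neg, h0']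
    | zero =>
      have := transfer (MvPolynomial.X (Sum.inl j)) (by simp [hj, hreal])
      simp only [MvPolynomial.aeval_X, lvGens_inl] at this
      rw [this, hreal, Literature.ModelTheory.ExponentialFields.Language.expRing.funMap_zero]
    | one =>
      have := transfer (MvPolynomial.X (Sum.inl j) - 1) (by simp [hj, hreal])
      simp only [map_sub, map_one, MvPolynomial.aeval_X, lvGens_inl, sub_eq_zero] at this
      rw [this, hreal, Literature.ModelTheory.ExponentialFields.Language.expRing.funMap_one]
    | exp =>
      obtain ⟨j₀, h0, h0'⟩ := hargs 0
      have := transfer (MvPolynomial.X (Sum.inl j) - MvPolynomial.X (Sum.inr j₀))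
        (by simp [hj, hreal, h0])
      simp only [map_sub, MvPolynomial.aeval_X, lvGens_inl, lvGens_zero_inr, sub_eq_zero] at this
      rw [this, hreal, Literature.ModelTheory.ExponentialFields.Language.expRing.funMap_exp, h0']

/-- **The Γ-isomorphisms over `K` between strong finitely generated subspaces form a
back-and-forth system** for `L_exp = ⟨+, ·, -, 0, 1, exp⟩` (with parameter valuations covered by
the states): related tuples satisfy the same atomic formulas (`exists_state_realize_term` and
transfer of equalities), and every element can be added on either side
(`IsGammaIso.exists_extension` and symmetry). [cite: BaysKirby2018ANT, Thm 6.9 (proof)] -/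
theorem isBackAndForth_gammaIso {α : Type*} (v v' : α → F) :
    Literature.ModelTheory.ExponentialFields.Language.expRing.IsBackAndForth v v' fun n (xs ys : Fin n → F) =>
      ∃ (N : ℕ) (c c' : Fin N → F), IsGammaIso K c c' ∧
        IsStrong (K ⊔ Submodule.span ℚ (range c)) ∧ IsStrong (K ⊔ Submodule.span ℚ (range c')) ∧
        (∀ i, ∃ j, c j = v i ∧ c' j = v' i) ∧ (∀ i, ∃ j, c j = xs i ∧ c' j = ys i) := by
  classical
  refine ⟨?_, ?_, ?_⟩
  · -- atomic formulas
    rintro n xs ys ⟨N, c, c', hiso, hs, hs', hv, hx⟩ φ hφ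
    cases hφ with
    | equal t₁ t₂ =>
      obtain ⟨N₁, c₁, c₁', hiso₁, hs₁, hs₁', hcov₁, j₁, hj₁, hj₁'⟩ :=
        exists_state_realize_term hF hsurj hEAC hccp hAx hSAT hKΓ hKtop hKc t₁ hiso hs hs' hv hx
      have hv₁ : ∀ i, ∃ j, c₁ j = v i ∧ c₁' j = v' i := fun i => by
        obtain ⟨j, hj, hj'⟩ := hv i
        obtain ⟨j', h1, h1'⟩ := hcov₁ j
        exact ⟨j', h1.trans hj, h1'.trans hj'⟩
      have hx₁ : ∀ i, ∃ j, c₁ j = xs i ∧ c₁' j = ys i := fun i => by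
        obtain ⟨j, hj, hj'⟩ := hx i
        obtain ⟨j', h1, h1'⟩ := hcov₁ j
        exact ⟨j', h1.trans hj, h1'.trans hj'⟩
      obtain ⟨N₂, c₂, c₂', hiso₂, hs₂, hs₂', hcov₂, j₂, hj₂, hj₂'⟩ :=
        exists_state_realize_term hF hsurj hEAC hccp hAx hSAT hKΓ hKtop hKc t₂ hiso₁ hs₁ hs₁'
          hv₁ hx₁
      obtain ⟨j₁', h1, h1'⟩ := hcov₂ j₁
      rw [BoundedFormula.realize_bdEqual, BoundedFormula.realize_bdEqual, ← hj₁, ← hj₁', ← h1,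
        ← h1',
        ← hj₂, ← hj₂']
      exact hiso₂.apply_eq_iff j₁' j₂
    | rel R ts => exact (show Empty from R).elim
  · -- forth
    rintro n xs ys ⟨N, c, c', hiso, hs, hs', hv, hx⟩ a
    obtain ⟨k, e, e', he0, hiso₁, hs₁, hs₁'⟩ :=
      hiso.exists_extension hF hsurj hEAC hccp hAx hSAT hKΓ hKtop hKc hs hs' a
    refine ⟨e' 0, N + (k + 1), Fin.append c e, Fin.append c' e', hiso₁, hs₁, hs₁', fun i => ?_,
      fun i => ?_⟩
    · obtain ⟨j, hj, hj'⟩ := hv i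
      exact ⟨Fin.castAdd (k + 1) j, by rw [Fin.append_left, hj], by rw [Fin.append_left, hj']⟩
    · refine Fin.lastCases ?_ (fun i => ?_) i
      · refine ⟨Fin.natAdd N 0, ?_, ?_⟩
        · rw [Fin.append_right, he0, Fin.snoc_last]
        · rw [Fin.append_right, Fin.snoc_last]
      · obtain ⟨j, hj, hj'⟩ := hx i
        exact ⟨Fin.castAdd (k + 1) j, by rw [Fin.append_left, hj, Fin.snoc_castSucc],
          by rw [Fin.append_left, hj', Fin.snoc_castSucc]⟩
  · -- back (by symmetry)
    rintro n xs ys ⟨N, c, c', hiso, hs, hs', hv, hx⟩ b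
    obtain ⟨k, e, e', he0, hiso₁, hs₁, hs₁'⟩ :=
      hiso.symm.exists_extension hF hsurj hEAC hccp hAx hSAT hKΓ hKtop hKc hs' hs b
    refine ⟨e' 0, N + (k + 1), Fin.append c e', Fin.append c' e, hiso₁.symm, hs₁', hs₁, fun i => ?_,
      fun i => ?_⟩
    · obtain ⟨j, hj, hj'⟩ := hv i
      exact ⟨Fin.castAdd (k + 1) j, by rw [Fin.append_left, hj], by rw [Fin.append_left, hj']⟩
    · refine Fin.lastCases ?_ (fun i => ?_) i
      · refine ⟨Fin.natAdd N 0, ?_, ?_⟩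
        · rw [Fin.append_right, Fin.snoc_last]
        · rw [Fin.append_right, he0, Fin.snoc_last]
      · obtain ⟨j, hj, hj'⟩ := hx i
        exact ⟨Fin.castAdd (k + 1) j, by rw [Fin.append_left, hj, Fin.snoc_castSucc],
          by rw [Fin.append_left, hj', Fin.snoc_castSucc]⟩

end Karp

/-! ### Cor. 11.7 (exponential case) and Thm 1.5 from the named facts -/

section Main

open FirstOrder FirstOrder.Language GammaField

/-- **Bays–Kirby 2018, Cor. 11.7 in the exponential case, from the named facts.** Let `F` be an
exponential field of characteristic `0` which is algebraically closed with `exp` onto `Fˣ` (a full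
Γ-field), has the countable closure property and is exponentially-algebraically closed. Granted
Ax's theorem (`ax_schanuel`) and Bays–Kirby's saturation
(`BaysKirby2018_saturation_of_isExpAlgClosed`, Props 11.2 + 11.5), `F` is quasiminimal. Proof (Thm 11.6 with `K = ecl ∅`, made explicit): a definable set `S = φ(F, b)`
has finitely many parameters `b`; `H = ecl b` is countable (CCP) and Γ-closed (Kirby's Thm 1.2,
`isGammaClosed_span_ecl`); for `a, a' ∉ H`, the hull `D₀` of `K + ℚb` inside `H` is strong and
`(D₀, a) ↦ (D₀, a')` is a Γ-isomorphism over `K` between strong subspaces (Lemma 4.13,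
`IsGammaIso.snoc`), i.e. a state of the back-and-forth system `isBackAndForth_gammaIso`; by
Karp's lemma `a ∈ S ↔ a' ∈ S`. Hence `S ⊆ H` or `F ∖ S ⊆ H`. (Countable `F` are trivially
quasiminimal.) [cite: BaysKirby2018ANT, Cor. 11.7, Thm 11.6] -/
theorem isQuasiminimal_of_isExpAlgClosed_of_ccp_of_facts {F : Type} [Field F] [CharZero F]
    [Literature.ModelTheory.ExponentialFields.ExponentialRing F] (hAx : Transcendental.ax_schanuel)
    (hSAT : BaysKirby2018_saturation_of_isExpAlgClosed.{0})
    (hF : IsAlgClosed F) (hsurj : Literature.ModelTheory.ExponentialFields.ExponentialRing.IsSurjectiveOntoUnits F)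
    (hccp : HasCountableClosureProperty F) (hEAC : IsExpAlgClosed F) :
    Literature.ModelTheory.ExponentialFields.Language.expRing.IsQuasiminimal F := by
  classical
  intro S hS
  by_cases hcount : Countable F
  · exact Or.inl S.to_countable
  haveI : Uncountable F := not_countable_iff.1 hcount
  -- finitely many parameters and a defining formula
  obtain ⟨A₀, -, hA₀⟩ := Set.definable_iff_finitely_definable.1 hS
  obtain ⟨φ, hφ⟩ := Set.definable_iff_exists_formula_sum.1 hA₀
  set k := Fintype.card (A₀ : Set F) with hk
  let eA : (A₀ : Set F) ≃ Fin k := Fintype.equivFin _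
  let b : Fin k → F := fun i => (eA.symm i : F)
  have hmem : ∀ a : F, a ∈ S ↔ φ.Realize (Sum.elim ((↑) : ↥(A₀ : Set F) → F) ![a]) := by
    intro a
    have := Set.ext_iff.1 hφ ![a]
    simpa only [Set.mem_setOf_eq, Matrix.cons_val_fin_one] using this
  let g : (A₀ : Set F) ⊕ Fin 1 → Fin (k + 1) := Sum.elim (Fin.castSucc ∘ eA) fun _ => Fin.last k
  have hg : ∀ a : F, (Fin.snoc b a : Fin (k + 1) → F) ∘ g =
      Sum.elim ((↑) : ↥(A₀ : Set F) → F) ![a] := by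
    intro a
    funext x
    rcases x with x | x
    · simp [g, b]
    · simp [g]
  have hmem' : ∀ a : F, a ∈ S ↔ (φ.relabel g).Realize (Fin.snoc b a : Fin (k + 1) → F) := by
    intro a
    rw [hmem, Formula.realize_relabel, hg]
  -- the base `K = ecl ∅` and the closed set `H = ecl b`
  set K : Submodule ℚ F := Submodule.span ℚ (ecl (∅ : Set F)) with hK
  have hKΓ : IsGammaClosed K := isGammaClosed_span_ecl hAx ∅
  have hKc : (K : Set F).Countable := countable_span_ecl hccp countable_empty
  have hKtop : K ≠ ⊤ := by
    intro htop
    apply not_countable_univ (α := F)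
    have : ((⊤ : Submodule ℚ F) : Set F) = univ := rfl
    rw [← this, ← htop]
    exact hKc
  set H : Submodule ℚ F := Submodule.span ℚ (ecl (range b)) with hH
  have hHΓ : IsGammaClosed H := isGammaClosed_span_ecl hAx (range b)
  have hHc : (ecl (range b)).Countable := hccp _ (countable_range b)
  have hKH : K ≤ H := span_ecl_mono (empty_subset _)
  have hΛ₁H : K ⊔ Submodule.span ℚ (range b) ≤ H := sup_le hKH (span_le_span_ecl _)
  have hfg₁ : IsFG K (K ⊔ Submodule.span ℚ (range b)) :=
    isFG_sup_left.2 (isFG_span_of_finite K (finite_range b))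
  obtain ⟨D₀, hΛ₁D₀, hD₀H, hfgD₀, hD₀⟩ :=
    hKΓ.isStrong.exists_isStrong_of_le hHΓ.isStrong le_sup_left hΛ₁H hfg₁
  obtain ⟨s, hsD₀, hD₀le⟩ := isFG_iff_exists_finset.1 hfgD₀
  let c₀ : Fin (s.card + k) → F := Fin.append (fun i => ((s.equivFin.symm i : s) : F)) b
  have hsrange : range (fun i : Fin s.card => ((s.equivFin.symm i : s) : F)) = (s : Set F) := by
    ext x
    constructor
    · rintro ⟨i, rfl⟩; exact (s.equivFin.symm i).2
    · intro hx; exact ⟨s.equivFin ⟨x, hx⟩, by simp⟩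
  have hc₀ : K ⊔ Submodule.span ℚ (range c₀) = D₀ := by
    have hr : range c₀ = (s : Set F) ∪ range b := by
      show range (Fin.append _ _) = _
      rw [ZilberHomogeneity.range_append, hsrange]
    rw [hr]
    refine le_antisymm (sup_le (le_sup_left.trans hΛ₁D₀)
      (Submodule.span_le.2 (union_subset hsD₀ ?_))) ?_
    · exact fun x hx => hΛ₁D₀ (Submodule.mem_sup_right (Submodule.subset_span hx))
    · exact hD₀le.trans (sup_le_sup_left (Submodule.span_mono subset_union_left) _)
  -- all points outside `H` behave alike
  have hgen : ∀ ⦃a a' : F⦄, a ∉ ecl (range b) → a' ∉ ecl (range b) → (a ∈ S ↔ a' ∈ S) := by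
    intro a a' ha ha'
    have haH : a ∉ H := by rwa [hH, mem_span_ecl_iff]
    have ha'H : a' ∉ H := by rwa [hH, mem_span_ecl_iff]
    obtain ⟨hDa, ha1⟩ := hD₀.sup_span_singleton hHΓ hD₀H haH
    obtain ⟨hDa', ha'1⟩ := hD₀.sup_span_singleton hHΓ hD₀H ha'H
    have haD : a ∉ D₀ := fun h => haH (hD₀H h)
    have ha'D : a' ∉ D₀ := fun h => ha'H (hD₀H h)
    have htda : td (K ⊔ Submodule.span ℚ (range c₀)) (Submodule.span ℚ {a}) = 2 := by
      rw [hc₀]; exact td_span_singleton_eq_two haD ha1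
    have htda' : td (K ⊔ Submodule.span ℚ (range c₀)) (Submodule.span ℚ {a'}) = 2 := by
      rw [hc₀]; exact td_span_singleton_eq_two ha'D ha'1
    have hstart : IsGammaIso K (Fin.snoc c₀ a : Fin (s.card + k + 1) → F) (Fin.snoc c₀ a') :=
      (IsGammaIso.refl K c₀).snoc htda htda'
    have hsa :
        IsStrong (K ⊔ Submodule.span ℚ (range (Fin.snoc c₀ a : Fin (s.card + k + 1) → F))) := by
      rw [sup_span_range_snoc, hc₀]; exact hDa
    have hsa' :
        IsStrong (K ⊔ Submodule.span ℚ (range (Fin.snoc c₀ a' : Fin (s.card + k + 1) → F))) := by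
      rw [sup_span_range_snoc, hc₀]; exact hDa'
    have hBF := isBackAndForth_gammaIso hF hsurj hEAC hccp hAx hSAT hKΓ hKtop hKc
      (Fin.snoc b a : Fin (k + 1) → F) (Fin.snoc b a')
    have hcov : ∀ i : Fin (k + 1), ∃ j,
        (Fin.snoc c₀ a : Fin (s.card + k + 1) → F) j = (Fin.snoc b a : Fin (k + 1) → F) i ∧
        (Fin.snoc c₀ a' : Fin (s.card + k + 1) → F) j = (Fin.snoc b a' : Fin (k + 1) → F) i := by
      intro i
      refine Fin.lastCases ?_ (fun i => ?_) i
      · exact ⟨Fin.last _, by simp only [Fin.snoc_last], by simp only [Fin.snoc_last]⟩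
      · refine ⟨Fin.castSucc (Fin.natAdd s.card i), ?_, ?_⟩
        · rw [Fin.snoc_castSucc, Fin.snoc_castSucc]; exact Fin.append_right _ _ i
        · rw [Fin.snoc_castSucc, Fin.snoc_castSucc]; exact Fin.append_right _ _ i
    have key := realize_iff_of_isBackAndForth hBF (φ.relabel g) (xs := default) (ys := default)
      ⟨_, Fin.snoc c₀ a, Fin.snoc c₀ a', hstart, hsa, hsa', hcov, fun i => i.elim0⟩
    rw [hmem' a, hmem' a']
    exact key
  by_cases hex : ∃ a ∈ S, a ∉ ecl (range b)
  · obtain ⟨a, haS, haH⟩ := hex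
    refine Or.inr (hHc.mono fun x hx => ?_)
    by_contra hxH
    exact hx ((hgen haH hxH).1 haS)
  · refine Or.inl (hHc.mono fun a ha => ?_)
    by_contra haH
    exact hex ⟨a, ha, haH⟩

/-- **Bays–Kirby 2018, Cor. 11.7** (exponential case, universe `0`) — the named fact
`Literature.NumberTheory.Transcendental.BaysKirby2018_isQuasiminimal_of_isExpAlgClosed_of_ccp` of `ZilberProofs.lean` — from
Ax's theorem and Bays–Kirby's saturation Props 11.2 + 11.5. [cite: BaysKirby2018ANT, Cor. 11.7] -/
theorem BaysKirby2018_isQuasiminimal_of_isExpAlgClosed_of_ccp_of_facts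
    (hAx : Transcendental.ax_schanuel) (hSAT : BaysKirby2018_saturation_of_isExpAlgClosed.{0}) :
    BaysKirby2018_isQuasiminimal_of_isExpAlgClosed_of_ccp.{0} :=
  fun hF hsurj hccp hEAC => isQuasiminimal_of_isExpAlgClosed_of_ccp_of_facts hAx hSAT hF hsurj hccp hEAC

/-- **Bays–Kirby 2018, Cor. 11.7** (exponential case, universe `0`) from Bays–Kirby's saturation
Props 11.2 + 11.5 alone, Ax's theorem being proved in the tree
(`Literature.NumberTheory.Transcendental.ax_schanuel_holds`, via Rosenlicht 1976 Prop. 4).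
[cite: BaysKirby2018ANT, Cor. 11.7] -/
theorem BaysKirby2018_isQuasiminimal_of_isExpAlgClosed_of_ccp_of_saturation
    (hSAT : BaysKirby2018_saturation_of_isExpAlgClosed.{0}) :
    BaysKirby2018_isQuasiminimal_of_isExpAlgClosed_of_ccp.{0} :=
  BaysKirby2018_isQuasiminimal_of_isExpAlgClosed_of_ccp_of_facts Transcendental.ax_schanuel_holds hSAT

end Main

end Literature.NumberTheory.Transcendental

namespace Literature.NumberTheory.Transcendental

open FirstOrder

/-- **Bays–Kirby 2018, Theorem 1.5** (`ℂ_exp` EAC ⟹ quasiminimal) — the named fact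
`Literature.NumberTheory.Transcendental.isQuasiminimal_of_isExpAlgClosed` — from the two deep results on which the printed
proof rests: Ax's theorem (Ax 1971 Thm 3, `Literature.NumberTheory.Transcendental.ax_schanuel`, behind Kirby's
Thm 1.2) and Bays–Kirby's `ℵ₀`-saturation Props 11.2 + 11.5
(`Literature.NumberTheory.Transcendental.BaysKirby2018_saturation_of_isExpAlgClosed`, weak Zilber–Pink); everything else — CCP for
`ℂ_exp` (Zilber 2005 Lemma 5.12, `hasCountableClosureProperty_complex_holds`), Kirby's Thm 1.2
from Ax (`Literature.NumberTheory.Transcendental.succ_le_relTrdeg_of_isEclClosed`), the Γ-field algebra of §§3–4, Karp's lemma and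
the back-and-forth of §6/§11 — is proved. [cite: BaysKirby2018ANT, Thm 1.5] -/
theorem isQuasiminimal_of_isExpAlgClosed_of_facts (hAx : Transcendental.ax_schanuel)
    (hSAT : BaysKirby2018_saturation_of_isExpAlgClosed.{0}) :
    isQuasiminimal_of_isExpAlgClosed := fun hEAC =>
  isQuasiminimal_of_isExpAlgClosed_of_ccp_of_facts hAx hSAT Complex.isAlgClosed
    Literature.ModelTheory.ExponentialFields.ExponentialRing.isSurjectiveOntoUnits_complex hasCountableClosureProperty_complex_holds hEAC

/-- **Bays–Kirby 2018, Theorem 1.5** (`ℂ_exp` EAC ⟹ quasiminimal) from the single remaining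
named fact `Literature.NumberTheory.Transcendental.BaysKirby2018_saturation_of_isExpAlgClosed` (Props 11.2 + 11.5: `ℵ₀`-saturation
of Γ-closed fields for Γ-algebraic purely Γ-transcendental extensions, via the weak Zilber–Pink
theorem), Ax's theorem being proved in the tree (`Literature.NumberTheory.Transcendental.ax_schanuel_holds`).
[cite: BaysKirby2018ANT, Thm 1.5] -/
theorem isQuasiminimal_of_isExpAlgClosed_of_saturation
    (hSAT : BaysKirby2018_saturation_of_isExpAlgClosed.{0}) :
    isQuasiminimal_of_isExpAlgClosed :=
  isQuasiminimal_of_isExpAlgClosed_of_facts Transcendental.ax_schanuel_holds hSAT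

end Literature.NumberTheory.Transcendental
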